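import Summits.HodgeConjecture.HodgeConjecture.Theorems.MarkmanPartnerTransportPicardThreeK3SquaresQuadraticGenerator
import Summits.HodgeConjecture.HodgeConjecture.Theorems.MarkmanPartnerTransportKugaSatakeSimilitudeVarescoFree

/-!
# Route MarkmanPartnerTransport · crux `PicardThreeK3Squares` (stmt-HodgeConjecture-19652) —
# the crux-#4 Kuga–Satake residue theorems WITHOUT the named fact `Varesco2023_…`

Gen 9's Kuga–Satake chain (`…KugaSatakeSimilitude` → `…KugaSatakeQuadraticThird` → `…QuadraticGenerator`)
made the real-quadratic RM K3 squares (`ρ(S) ∈ {8, 12, 14, 16}` and every `QuadGen` surface)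
CONDITIONAL on the Kuga–Satake statement for `S` AND on the named fact
`Surfaces.Varesco2023_transcendentalHodgeSimilitude_algebraic_of_kugaSatake_K3`. The programme «KS-SELF»
(gen 14: `…TranscendentalPresentation`, `…KugaSatakeSimilarTransport`, `…KugaSatakeSelfPresentation`,
`…KugaSatakeSelfClassMap`, `…KugaSatakeSelfTranspose`, `…KugaSatakeSelfDescent`,
`…KugaSatakeSelfSimilitude`, `…KugaSatakeSimilitudeVarescoFree`) proved the self-similitude case of
Varesco's theorem in the tree. This file re-derives the by-name endpoints of the chain with `hVar` REMOVED:

* `hodgeConjectureFor_square_of_quadraticGenerator_of_kugaSatake'` — HC⁴(S × S) for a marked `QuadGen`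
  surface ⟸ KSHC(S);
* `hodgeConjectureFor_square_of_kugaSatake_of_rank'`, `hodgeConjectureFor_square_of_kugaSatake_of_picard_mem'`
  — **«Kuga–Satake for `S` ⇒ HC⁴(S × S)» for every marked projective K3 surface with
  `ρ(S) ∈ {8, 12, 14, 16}`**, modulo Buskin (CM branch) and markings ONLY;
* `picardThreeK3Squares_of_kugaSatake_of_oneCycle_off_quadratic'`,
  `picardThreeK3Squares_of_kugaSatake_of_realMultiplicationThird_off_quadratic'`,
  `picardThreeK3Squares_of_kugaSatake_of_oneCycle_low_ranks'` — **the crux BY NAME** from Kuga–Satake on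
  the real-quadratic surfaces plus the one-cycle ∕ sector clause on the degree-`≥ 3` surfaces
  (`ρ(S) ∈ {4, 6, 7, 10, 13}`), modulo {Buskin2019, Huybrechts marking} — no Varesco fact.

CONDITIONAL (the Kuga–Satake statements are hypotheses, open in print; facts Buskin2019 and
`Huybrechts_K3_marking_exists` as displayed); no definition, no new named fact, no sorry; credits nothing
to the Hodge conjecture — nothing here says HC or the crux is proved. Prover seat hodge-nonav-19652-p1
(gen 14), `--supports stmt-HodgeConjecture-19652`.

References: M. Varesco, Math. Z. 305 (2023), Thm. 5.3 and Conj. 4.2; B. van Geemen, *Real multiplication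
on K3 surfaces and Kuga–Satake varieties* (2008), Lemma 3.2; van Geemen–Schütt, Forum Math. Sigma 13
(2025), §4.8 and Rem. 4.9; N. Buskin, J. reine angew. Math. 755 (2019), Thm. 1.1; Yu. G. Zarhin (1983),
Thm. 1.5.1.
-/

set_option linter.dupNamespace false

noncomputable section

namespace Summit.HodgeConjecture.HodgeConjecture.Theorems.MarkmanPartnerTransport.KugaSatakeSimilitude

open scoped Manifold TensorProduct
open Module CategoryTheory MonoidalCategory CartesianMonoidalCategory Polynomial
open Literature.AlgebraicGeometry Literature.AlgebraicGeometry.Motives Literature.AlgebraicGeometry.HodgeTheory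
open Literature.AlgebraicGeometry.Motives.HodgeStructure
open Literature.AlgebraicGeometry.Surfaces
open Literature.AlgebraicTopology.SingularHomology
open Summit.HodgeConjecture.HodgeConjecture.Theorems
open Summit.HodgeConjecture.HodgeConjecture.Theorems.NikulinTwinTransport
open Summit.HodgeConjecture.HodgeConjecture.Theorems.AnchorExistenceCMFloor
open Summit.HodgeConjecture.HodgeConjecture.Theorems.MarkmanPartnerTransport.RealMultiplicationRanks
open Summit.HodgeConjecture.HodgeConjecture.Theorems.MarkmanPartnerTransport.OneCycle
open Summit.HodgeConjecture.HodgeConjecture.Theses.MarkmanPartnerTransport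

variable {S : SchemeOver ℂ}

/-- `Transc[S, y]`: `y` is cup-orthogonal to `N¹(S)`. Local notation only. -/
local notation3 (prettyPrint := false) "Transc[" S ", " y "]" =>
  (∀ d ∈ algebraicClasses S 1, cupProduct (rfl : 2 * 1 + 2 * 1 = 2 * 2) y d = 0)

/-- `Scalar[S]`: «`End_Hdg T(S) = ℚ`» (VERBATIM the clause of `HighPicard`). Local notation only. -/
local notation3 (prettyPrint := false) "Scalar[" S "]" =>
  (∀ (f : complexBetti S (2 * 1) →ₗ[ℂ] complexBetti S (2 * 1)),
    (∀ y, IsRationalClass y → IsRationalClass (f y)) →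
    (∀ (i j : ℕ) y, IsOfHodgeType 2 S (2 * 1) i j y → IsOfHodgeType 2 S (2 * 1) i j (f y)) →
    (∀ d ∈ algebraicClasses S 1, f d = 0) →
    (∀ y : complexBetti S (2 * 1), ∀ d ∈ algebraicClasses S 1,
      cupProduct (rfl : 2 * 1 + 2 * 1 = 2 * 2) (f y) d = 0) →
    ∃ a : ℚ, ∀ y : complexBetti S (2 * 1),
      (∀ d ∈ algebraicClasses S 1, cupProduct (rfl : 2 * 1 + 2 * 1 = 2 * 2) y d = 0) →
        f y = (a : ℂ) • y)

/-- `QuadGen[S]`: a real-quadratic generator (VERBATIM the clause of `…KugaSatakeQuadraticThird`). Local notation only. -/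
local notation3 (prettyPrint := false) "QuadGen[" S "]" =>
  (∃ (ψ : complexBetti S (2 * 1) →ₗ[ℂ] complexBetti S (2 * 1)) (d : ℚ), d ≠ 0 ∧
    (∀ y, IsRationalClass y → IsRationalClass (ψ y)) ∧
    (∀ (i j : ℕ) y, IsOfHodgeType 2 S (2 * 1) i j y → IsOfHodgeType 2 S (2 * 1) i j (ψ y)) ∧
    (∀ d' ∈ algebraicClasses S 1, ψ d' = 0) ∧
    (∀ y : complexBetti S (2 * 1), Transc[S, ψ y]) ∧
    (∀ y w : complexBetti S (2 * 1),
      cupProduct (rfl : 2 * 1 + 2 * 1 = 2 * 2) (ψ y) w = cupProduct (rfl : 2 * 1 + 2 * 1 = 2 * 2) y (ψ w)) ∧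
    (∀ y : complexBetti S (2 * 1), Transc[S, y] → ψ (ψ y) = (d : ℂ) • y) ∧
    TranscendentalEndomorphismsGeneratedBy S ψ)

/-- `MarkedK3[S, η, p, x]`: VERBATIM the `let MarkedK3 := …` binder of the route declaration
`PicardThreeK3Squares`. Local notation only. -/
local notation3 (prettyPrint := false) "MarkedK3[" S ", " η ", " p ", " x "]" =>
  (p ≠ 0 ∧ (IsIntegralClass p ∧
    (∀ q : complexBetti S (2 * 2), IsIntegralClass q → ∃ n : ℤ, q = n • p) ∧
    (∀ c : complexBetti S (2 * 1), IsIntegralClass c ↔ ∃ v : K3Index → ℤ, η c = fun i => (v i : ℂ)) ∧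
    (∀ a b : complexBetti S (2 * 1),
      cupProduct (rfl : 2 * 1 + 2 * 1 = 2 * 2) a b = k3Form (η a) (η b) • p) ∧
    IsOfHodgeType 2 S (2 * 1) 2 0 (LinearEquiv.symm η x) ∧
    (∀ τ : complexBetti S (2 * 1), IsOfHodgeType 2 S (2 * 1) 2 0 τ →
      ∃ t : ℂ, τ = t • LinearEquiv.symm η x)) ∧
    (k3Form x x = 0 ∧ 0 < (k3Form (star x) x).re ∧
      ∃ u : K3Index → ℤ, k3Form (fun i => (u i : ℂ)) x = 0 ∧ 0 < ∑ i, ∑ j, u i * k3Gram i j * u j))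

/-- `Corr[μ, hS ; γ, y] = fst_*(snd^* y ∪ γ)` on `H²(S(ℂ); ℂ)`. Local notation only. -/
local notation3 (prettyPrint := false) "Corr[" μ ", " hS " ; " γ ", " y "]" =>
  complexGysin μ (IsSmoothProjective.tensor_holds hS hS) hS
    (SemiCartesianMonoidalCategory.fst _ _) (rfl : 2 * 1 + 2 * 2 + 2 * 2 = 2 * 1 + 2 * (2 + 2))
    (cupProduct (rfl : 2 * 1 + 2 * 2 = 2 * 1 + 2 * 2)
      (complexBetti.map (SemiCartesianMonoidalCategory.snd _ _) (2 * 1) y) γ)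

/-- `OneCycleOfDegree[S, hS]` (VERBATIM the clause of `…OneCycleThird`). Local notation only. -/
local notation3 (prettyPrint := false) "OneCycleOfDegree[" S ", " hS "]" =>
  (∃ (k : ℕ) (e : complexBetti S (2 * 1) →ₗ[ℂ] complexBetti S (2 * 1)),
    (∀ j m : ℕ, 2 ≤ j → 3 ≤ m → k * j * m + Module.finrank ℂ ↥(algebraicClasses S 1) ≠ 22) ∧
    (∀ y, IsRationalClass y → IsRationalClass (e y)) ∧
    (∀ (i j : ℕ) y, IsOfHodgeType 2 S (2 * 1) i j y → IsOfHodgeType 2 S (2 * 1) i j (e y)) ∧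
    (∃ γ ∈ algebraicClasses (S ⊗ S) 2, ∀ y : complexBetti S (2 * 1),
      e y = Corr[complexOrientationFamily, IsK3Surface.isSmoothProjective hS ; γ, y]) ∧
    (∃ (σ₀ : complexBetti S (2 * 1)) (ev : ℂ), IsOfHodgeType 2 S (2 * 1) 2 0 σ₀ ∧ σ₀ ≠ 0 ∧
      e σ₀ = ev • σ₀ ∧ (minpoly ℚ ev).natDegree = k))

/-- `SectorClause[S, hS]`: the cycle-induced sector clause (Varesco's normal form; VERBATIM the consequent
of `CMThird.picardThreeK3Squares_of_realMultiplicationThird`). Local notation only. -/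
local notation3 (prettyPrint := false) "SectorClause[" S ", " hS "]" =>
  (∀ (f : complexBetti S (2 * 1) →ₗ[ℂ] complexBetti S (2 * 1)),
    (∀ y, IsRationalClass y → IsRationalClass (f y)) →
    (∀ (i j : ℕ) y, IsOfHodgeType 2 S (2 * 1) i j y → IsOfHodgeType 2 S (2 * 1) i j (f y)) →
    (∀ d ∈ algebraicClasses S 1, f d = 0) →
    (∀ y : complexBetti S (2 * 1), ∀ d ∈ algebraicClasses S 1,
      cupProduct (rfl : 2 * 1 + 2 * 1 = 2 * 2) (f y) d = 0) →
    ∃ g : complexBetti S (2 * 1) →ₗ[ℂ] complexBetti S (2 * 1),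
      (∀ d ∈ algebraicClasses S 1, g d ∈ algebraicClasses S 1) ∧
      (∃ γ ∈ algebraicClasses (S ⊗ S) 2, ∀ y : complexBetti S (2 * 1),
        g y = Corr[complexOrientationFamily, IsK3Surface.isSmoothProjective hS ; γ, y]) ∧
      ∀ y : complexBetti S (2 * 1), Transc[S, y] → f y = g y)

/-! ### The per-surface statements, Varesco-free -/

/-- **HC⁴(S × S) for a marked projective K3 surface with a real-quadratic generator, granted Kuga–Satake
for `S` — no named fact** (`QuadGen[S]` unpacked into
`hodgeConjectureFor_square_of_selfSimilitude_generator_of_kugaSatake'`). CONDITIONAL (Kuga–Satake hypothesis).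
[cite: Varesco2023, Thm. 5.3 and Conj. 4.2] [cite: GeemenSchutt2023, §2.1 and §4.8] -/
theorem hodgeConjectureFor_square_of_quadraticGenerator_of_kugaSatake'
    (hS : IsK3Surface S) {η : complexBetti S (2 * 1) ≃ₗ[ℂ] (K3Index → ℂ)} {p : complexBetti S (2 * 2)}
    {x : K3Index → ℂ} (hM : MarkedK3[S, η, p, x])
    (hKS : IsKSCorrespondenceAlgebraicBetti hS.isSmoothProjective) (hQ : QuadGen[S]) :
    HodgeConjectureFor 4 (S ⊗ S) := by
  obtain ⟨ψ, d, hd, h1, h2, h3, h4, h5, hψψ, hgen⟩ := hQ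
  exact hodgeConjectureFor_square_of_selfSimilitude_generator_of_kugaSatake' hS hM hKS ψ h1 h2 h3 h4 h5 d
    hd hψψ hgen

/-- **For a marked projective K3 surface with `22 − ρ(S) ∈ {6, 8, 10, 14}`, the Kuga–Satake statement for
`S` implies HC⁴(S × S)** — modulo Buskin's Thm. 1.1 (CM case) and markings ONLY (gen 9's
`hodgeConjectureFor_square_of_kugaSatake_of_rank` without `hVar`). CONDITIONAL; credits nothing to HC.
[cite: Varesco2023, Thm. 5.3 and Conj. 4.2] [cite: Vangeemen2008, Lemma 3.2] [cite: Buskin2019, Thm. 1.1] -/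
theorem hodgeConjectureFor_square_of_kugaSatake_of_rank' (hB : Buskin2019_hodgeIsometry_algebraic)
    (hmark : Huybrechts_K3_marking_exists) (hS : IsK3Surface S)
    {η : complexBetti S (2 * 1) ≃ₗ[ℂ] (K3Index → ℂ)} {p : complexBetti S (2 * 2)} {x : K3Index → ℂ}
    (hM : MarkedK3[S, η, p, x])
    (hρ : ∀ d m : ℕ, 2 ≤ d → 3 ≤ m → d * m + Module.finrank ℂ ↥(algebraicClasses S 1) = 22 → d = 2)
    (hKS : IsKSCorrespondenceAlgebraicBetti hS.isSmoothProjective) :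
    HodgeConjectureFor 4 (S ⊗ S) := by
  by_cases hCM : HasComplexMultiplication S
  · exact CMThird.hodgeConjectureFor_square_of_CM_of_buskin hB hmark S hS hCM
  · by_cases hQ : Scalar[S]
    · exact SquareGlueFree.hodgeConjectureFor_square_of_hodgeEndomorphisms_scalar hS.isSmoothProjective hQ
    · exact hodgeConjectureFor_square_of_quadraticGenerator_of_kugaSatake' hS hM hKS
        (exists_quadraticGenerator_of_not_scalar hmark hS hρ hCM hQ)

/-- **«Kuga–Satake for `S` ⇒ HC⁴(S × S)» for every marked projective K3 surface with `ρ(S) ∈ {8, 12, 14, 16}`**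
— modulo Buskin (CM case) and markings ONLY; gen 9's statement without `hVar`. CONDITIONAL; credits nothing to HC.
[cite: Varesco2023, Thm. 5.3 and Conj. 4.2] [cite: Vangeemen2008, Lemma 3.2] -/
theorem hodgeConjectureFor_square_of_kugaSatake_of_picard_mem' (hB : Buskin2019_hodgeIsometry_algebraic)
    (hmark : Huybrechts_K3_marking_exists) (hS : IsK3Surface S)
    {η : complexBetti S (2 * 1) ≃ₗ[ℂ] (K3Index → ℂ)} {p : complexBetti S (2 * 2)} {x : K3Index → ℂ}
    (hM : MarkedK3[S, η, p, x])
    (hρ : Module.finrank ℂ ↥(algebraicClasses S 1) = 8 ∨ Module.finrank ℂ ↥(algebraicClasses S 1) = 12 ∨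
      Module.finrank ℂ ↥(algebraicClasses S 1) = 14 ∨ Module.finrank ℂ ↥(algebraicClasses S 1) = 16)
    (hKS : IsKSCorrespondenceAlgebraicBetti hS.isSmoothProjective) :
    HodgeConjectureFor 4 (S ⊗ S) :=
  hodgeConjectureFor_square_of_kugaSatake_of_rank' hB hmark hS hM
    (fun _ _ hd hm h => eq_two_of_mul_add_eq_of_mem hd hm h hρ) hKS

/-! ### The crux by name, Varesco-free -/

/-- **`PicardThreeK3Squares` BY NAME, the real-quadratic RM surfaces discharged modulo Kuga–Satake — no
Varesco fact** (gen 9's `picardThreeK3Squares_of_kugaSatake_of_oneCycle_off_quadratic` without `hVar`):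
granted Buskin's Thm. 1.1, markings, and the Kuga–Satake statement for every non-CM projective K3 surface
with `3 ≤ ρ(S) ≤ 16` carrying a real-quadratic generator, the crux follows from the one-cycle clause on the
non-CM, non-scalar surfaces with `3 ≤ ρ(S) ≤ 16` and NO real-quadratic generator. CONDITIONAL; credits
nothing to HC. [cite: Varesco2023, Thm. 5.3 and Conj. 4.2] [cite: GeemenSchutt2023, §4.8 and Rem. 4.9]
[cite: Buskin2019, Thm. 1.1] -/
theorem picardThreeK3Squares_of_kugaSatake_of_oneCycle_off_quadratic' (hB : Buskin2019_hodgeIsometry_algebraic)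
    (hmark : Huybrechts_K3_marking_exists)
    (hKS : ∀ (S : SchemeOver ℂ) (hS : IsK3Surface S), ¬ HasComplexMultiplication S →
      3 ≤ Module.finrank ℂ ↥(algebraicClasses S 1) → Module.finrank ℂ ↥(algebraicClasses S 1) ≤ 16 →
      QuadGen[S] → IsKSCorrespondenceAlgebraicBetti hS.isSmoothProjective)
    (hOne : ∀ (S : SchemeOver ℂ) (hS : IsK3Surface S), ¬ HasComplexMultiplication S →
      3 ≤ Module.finrank ℂ ↥(algebraicClasses S 1) → Module.finrank ℂ ↥(algebraicClasses S 1) ≤ 16 →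
      ¬ Scalar[S] → ¬ QuadGen[S] → OneCycleOfDegree[S, hS]) :
    PicardThreeK3Squares := by
  refine HighPicard.picardThreeK3Squares_of_realMultiplicationThird_le_sixteen hB hmark
    fun S hS hCM h3 h16 hQ ↦ SectorIff.cycleInducedSector_of_hodgeConjectureFor_square
      complexOrientationFamily hS.isSmoothProjective ?_
  by_cases hq : QuadGen[S]
  · obtain ⟨η, p, x, hM⟩ := hmark S hS
    exact hodgeConjectureFor_square_of_quadraticGenerator_of_kugaSatake' hS hM (hKS S hS hCM h3 h16 hq) hq
  · obtain ⟨k, e, hk, hrat, htyp, hcyc, hev⟩ := hOne S hS hCM h3 h16 hQ hq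
    exact OneCycle.hodgeConjectureFor_square_of_oneCycle_natDegree hmark hS hk hCM complexOrientationFamily e hrat
      htyp hcyc hev

/-- **`PicardThreeK3Squares` BY NAME from the sector clause off the real-quadratic surfaces, modulo
Kuga–Satake there — no Varesco fact** (gen 9's
`picardThreeK3Squares_of_kugaSatake_of_realMultiplicationThird_off_quadratic` without `hVar`). CONDITIONAL;
credits nothing to HC. [cite: Varesco2023, Thm. 5.3] [cite: Zarhin1983HodgeGroupsK3, Thm. 1.5.1] [cite: Buskin2019, Thm. 1.1] -/
theorem picardThreeK3Squares_of_kugaSatake_of_realMultiplicationThird_off_quadratic'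
    (hB : Buskin2019_hodgeIsometry_algebraic) (hmark : Huybrechts_K3_marking_exists)
    (hKS : ∀ (S : SchemeOver ℂ) (hS : IsK3Surface S), ¬ HasComplexMultiplication S →
      3 ≤ Module.finrank ℂ ↥(algebraicClasses S 1) → QuadGen[S] →
      IsKSCorrespondenceAlgebraicBetti hS.isSmoothProjective)
    (hRM : ∀ (S : SchemeOver ℂ) (hS : IsK3Surface S), ¬ HasComplexMultiplication S →
      3 ≤ Module.finrank ℂ ↥(algebraicClasses S 1) → ¬ Scalar[S] → ¬ QuadGen[S] → SectorClause[S, hS]) :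
    PicardThreeK3Squares := by
  intro S hS η p x hM hρ
  by_cases hCM : HasComplexMultiplication S
  · exact CMThird.hodgeConjectureFor_square_of_CM_of_buskin hB hmark S hS hCM
  · by_cases hQ : Scalar[S]
    · exact SquareGlueFree.hodgeConjectureFor_square_of_hodgeEndomorphisms_scalar hS.isSmoothProjective hQ
    · by_cases hq : QuadGen[S]
      · exact hodgeConjectureFor_square_of_quadraticGenerator_of_kugaSatake' hS hM (hKS S hS hCM hρ hq) hq
      · exact CycleInducedSector.hodgeConjectureFor_square_of_cycleInducedSector complexOrientationFamily
          hS.isSmoothProjective (hRM S hS hCM hρ hQ hq)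

/-- **`PicardThreeK3Squares` BY NAME, residue = RM of degree `≥ 3` at `ρ(S) ∈ {4, 6, 7, 10, 13}`, modulo
Kuga–Satake on the real-quadratic surfaces — no Varesco fact** (gen 9's
`picardThreeK3Squares_of_kugaSatake_of_oneCycle_low_ranks` without `hVar`). CONDITIONAL; credits nothing to HC.
[cite: Varesco2023, Thm. 5.3 and Conj. 4.2] [cite: Vangeemen2008, Lemma 3.2] [cite: GeemenSchutt2023, §4.8 and Rem. 4.9]
[cite: Buskin2019, Thm. 1.1] -/
theorem picardThreeK3Squares_of_kugaSatake_of_oneCycle_low_ranks' (hB : Buskin2019_hodgeIsometry_algebraic)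
    (hmark : Huybrechts_K3_marking_exists)
    (hKS : ∀ (S : SchemeOver ℂ) (hS : IsK3Surface S), ¬ HasComplexMultiplication S →
      3 ≤ Module.finrank ℂ ↥(algebraicClasses S 1) → Module.finrank ℂ ↥(algebraicClasses S 1) ≤ 16 →
      QuadGen[S] → IsKSCorrespondenceAlgebraicBetti hS.isSmoothProjective)
    (hOne : ∀ (S : SchemeOver ℂ) (hS : IsK3Surface S), ¬ HasComplexMultiplication S →
      (Module.finrank ℂ ↥(algebraicClasses S 1) = 4 ∨ Module.finrank ℂ ↥(algebraicClasses S 1) = 6 ∨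
        Module.finrank ℂ ↥(algebraicClasses S 1) = 7 ∨ Module.finrank ℂ ↥(algebraicClasses S 1) = 10 ∨
        Module.finrank ℂ ↥(algebraicClasses S 1) = 13) →
      ¬ Scalar[S] → ¬ QuadGen[S] → OneCycleOfDegree[S, hS]) :
    PicardThreeK3Squares := by
  refine picardThreeK3Squares_of_kugaSatake_of_oneCycle_off_quadratic' hB hmark hKS
    fun S hS hCM h3 h16 hQ hq ↦ ?_
  by_cases hlow : Module.finrank ℂ ↥(algebraicClasses S 1) = 4 ∨ Module.finrank ℂ ↥(algebraicClasses S 1) = 6 ∨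
      Module.finrank ℂ ↥(algebraicClasses S 1) = 7 ∨ Module.finrank ℂ ↥(algebraicClasses S 1) = 10 ∨
      Module.finrank ℂ ↥(algebraicClasses S 1) = 13
  · exact hOne S hS hCM hlow hQ hq
  · exfalso
    by_cases hquad : Module.finrank ℂ ↥(algebraicClasses S 1) = 8 ∨ Module.finrank ℂ ↥(algebraicClasses S 1) = 12 ∨
        Module.finrank ℂ ↥(algebraicClasses S 1) = 14 ∨ Module.finrank ℂ ↥(algebraicClasses S 1) = 16
    · exact hq (exists_quadraticGenerator_of_not_scalar hmark hS
        (fun _ _ hd hm h => eq_two_of_mul_add_eq_of_mem hd hm h hquad) hCM hQ)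
    · have hodd : Module.finrank ℂ ↥(algebraicClasses S 1) = 3 ∨ Module.finrank ℂ ↥(algebraicClasses S 1) = 5 ∨
          Module.finrank ℂ ↥(algebraicClasses S 1) = 9 ∨ Module.finrank ℂ ↥(algebraicClasses S 1) = 11 ∨
          Module.finrank ℂ ↥(algebraicClasses S 1) = 15 := by omega
      rcases RealMultiplicationRanks.scalar_or_hasComplexMultiplication_of_forall_mul_add_ne hmark hS
          (fun e m he hm => mul_add_ne_of_mem he hm hodd) with hsc | hcm
      · exact hQ hsc
      · exact hCM hcm

end Summit.HodgeConjecture.HodgeConjecture.Theorems.MarkmanPartnerTransport.KugaSatakeSimilitude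

end
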